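import Literature.Claims.NS.Strelzoff2026

/-!
# C110 `Strelzoff2026` — refuter companion facts (D-0090 NS-CLAIMS; refuter-8)

Kernel facts over the typed skeleton `Literature.Claims.NS.Strelzoff2026` (typist-7, p469156), complementing
its own records `capstone_holds`, `step_bridge_iff_claimedTheorem`, `finiteTypeCapstone_iff` and
`finiteType_trivial_model`:

* the two NS-carrying axioms of the v2 supplement (`galerkin_compactness`, GalerkinLimit.lean:60;
  `nielsen_critical_estimate`, CriticalEstimate.lean:54), transcribed over parameters, are NOT tautologies —
  each is false for some interpretation of the opaque carrier / axiomatised symbols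
  (`not_forall_axiom_galerkinCompactness`, `not_forall_axiom_nielsenCriticalEstimate`), while the skeleton's
  `finiteType_trivial_model` shows both true in the one-point model: as deposited (opaque type, uninterpreted
  predicate) they pin no statement about velocity fields;
* the v2 capstone `finiteType_regularity` itself is interpretation-dependent in the same way
  (`not_forall_finiteTypeCapstone` vs the trivial model);
* for EVERY interpretation in which the v2 capstone holds, its bridge to the abstract's sentence is
  equivalent to that sentence (`step_bridgeFT_iff_claimedTheorem`), exactly as `step_bridge_iff_claimedTheorem`
  records for the §1–§11 chain.

WHAT THIS IS NOT: not a claim about NS regularity or blow-up; not a claim about any author beyond the typed locator.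
-/

set_option linter.dupNamespace false

namespace Summit.NavierStokesRegularity.NavierStokesRegularity.Theorems.Strelzoff2026

open Literature.Claims.NS.Strelzoff2026

/-- `axiom galerkin_compactness` read as a statement about ALL interpretations of its symbols is false:
carrier `Unit`, `criticalNorm u t := t` (unbounded on `t ≥ 0`), chain contractivity `True`. -/
theorem not_forall_axiom_galerkinCompactness :
    ¬ ∀ F : FiniteTypeData, Axiom_galerkinCompactness F := by
  intro h
  obtain ⟨_, C, _, hb⟩ := h ⟨Unit, fun _ t => t, fun _ => True, True⟩ () 1 one_pos trivial
  have := hb (C + 1) (by linarith)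
  linarith

/-- `axiom nielsen_critical_estimate` read as a statement about ALL interpretations is false: carrier `Unit`,
`criticalNorm := 0`, `isGlobalSmoothSolution := False`. -/
theorem not_forall_axiom_nielsenCriticalEstimate :
    ¬ ∀ F : FiniteTypeData, Axiom_nielsenCriticalEstimate F := by
  intro h
  exact h ⟨Unit, fun _ _ => 0, fun _ => False, True⟩ () 1 one_pos (fun _ _ => zero_le_one)

/-- The v2 capstone `finiteType_regularity` (GalerkinLimit.lean:75), transcribed, is false in the model
carrier `Unit`, `isGlobalSmoothSolution := False` (and true in the one-point/`True` model,
`finiteType_trivial_model`): its truth value is fixed only by an interpretation the deposit does not give. -/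
theorem not_forall_finiteTypeCapstone : ¬ ∀ F : FiniteTypeData, FiniteTypeCapstone F := by
  intro h
  obtain ⟨_, hu⟩ := h ⟨Unit, fun _ _ => 0, fun _ => False, True⟩ () 1 one_pos
  exact hu

/-- For every interpretation in which the v2 capstone holds, the v2 bridge IS the abstract's sentence. -/
theorem step_bridgeFT_iff_claimedTheorem (F : FiniteTypeData) (h : FiniteTypeCapstone F) :
    Step_bridgeFT F ↔ ClaimedTheorem :=
  ⟨fun hb => hb h, fun hc _ => hc⟩

/-- In particular under the two axioms and uniform chain contractivity (the artefact's own hypotheses) the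
v2 bridge is equivalent to the claimed sentence: the axioms advance the claim by nothing checkable. -/
theorem step_bridgeFT_iff_of_axioms (F : FiniteTypeData) (hgc : Axiom_galerkinCompactness F)
    (hne : Axiom_nielsenCriticalEstimate F) (hucc : Step_uniformChainContractivity F) :
    Step_bridgeFT F ↔ ClaimedTheorem :=
  step_bridgeFT_iff_claimedTheorem F (finiteTypeCapstone_of_axioms F hgc hne hucc)

end Summit.NavierStokesRegularity.NavierStokesRegularity.Theorems.Strelzoff2026
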